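import Mathlib
import Summits.CriticalPhenomena.CardyFormulaZ2.Theorems.CardySelfRefinementTrivialSectorRateStubSixArmDecayReimer
import Summits.CriticalPhenomena.CardyFormulaZ2.Theorems.CardySelfRefinementTrivialSectorRateStubBoundaryRelevanceOpenArm
import Summits.CriticalPhenomena.CardyFormulaZ2.Theorems.CardySelfRefinementTrivialSectorRateStubSixArmDecayDualArm
import Literature.Probability.Percolation.Z2HalfPlaneThreeArm
import Literature.Probability.Percolation.LatticeSymmetry
import HarnessLib

/-!
# Stub `stub_boundaryRelevance` of line `far-field-is-a-quarter-turn` (crux `TrivialSectorRate`,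
stmt-CriticalPhenomena-10266): input (W2b) — the FREE-SIDE docked half-plane THREE-arm window
bound for `M_2` along an RSW path, exponent `1 + α`

Lawler–Schramm–Werner's three-arm half-plane estimate (Electron. J. Probab. 7 (2002), App. A,
display after Lemma A.1: "two open crossings and one closed crossing ... at most
`c (r/R)^{1+ε}`") in the window form of the tree's `Z2HalfPlane.real_threeArm_le`
(`Literature/Probability/Percolation/Z2HalfPlaneThreeArm.lean`, Bernoulli percolation), for the
dependent self-refinement law `M_2(γ s)` read after the vertical translation by `t`, and for the
ORDERED FREE three-arm event of the window `[j, j+m)`: open legs `a < a'` carrying open arms to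
sup-distance `R` and a closed dual arm from a moat face `b`, `a ≤ b < a'`, to sup-distance `2R`.

The law `M_2` is not a product measure on bond configurations, so Reimer's inequality is used on
the COIN space (`M_real_le_mul_of_preimage_subset_disjointOccurrence`, file
`…StubSixArmDecayReimer.lean`) through the coin-space inclusion
`cfg 2 ⁻¹' (three arms) ⊆ (cfg 2 ⁻¹' twoArm) □ (cfg 2 ⁻¹' oneArm)` (input (W2a), a hypothesis
here), together with the two-arm window bound (input (W1), a hypothesis here: exponent `1`) and
the price of the third arm:

* `determinedBy_preimage_relabel_symm_image` — relabelling transports finite dependence;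
* `determinedBy_threeArmFree` — the ordered free three-arm event is read off the pairs of
  `Z2HalfPlane.armSites j m (2R)` (hence measurable);
* `mem_union_of_relabel_shift_mem_oneArm` — if the translate `ω + p` of a lattice configuration
  has ONE arm from the window (`Z2HalfPlane.oneArm`), then `ω` has an open, or a dual-open,
  lattice walk from `c + B(M-1)` to the outside of `c + B(n')`, `c = (j,0) - p`, `n' + m ≤ R`;
* **`threeArmFree_window_along_two`** (registered, W2b) — assembly: Reimer on the coin space, the
  two-arm bound `C₂ m/n`, and the one-arm decays `openArm_decay_along` / `dualArm_decay_along`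
  (`≤ c (M/n')^a ≤ c' (m/n)^α`, `α` the smaller of the two exponents), giving `C (m/n)^{1+α}`.

References: G. F. Lawler, O. Schramm, W. Werner, Electron. J. Probab. 7 (2002), Appendix A;
W. Werner, *Lectures on two-dimensional critical percolation* (PCMI 2007), Lecture 2, first
exercise sheet; P. Nolin, Electron. J. Probab. 13 (2008), §4.1 (Reimer for arm events).

Target file:
`Summits/CriticalPhenomena/CardyFormulaZ2/Theorems/CardySelfRefinementTrivialSectorRateStubBoundaryRelevanceThreeArmFreeWindow.lean`.
-/

noncomputable section

namespace Summit.CriticalPhenomena.CardyFormulaZ2.Theorems.CardySelfRefinement.FarField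

open Set MeasureTheory
open Literature.Probability.LatticeModels Literature.Probability.Percolation
open Literature.Probability.Percolation.QuadCrossing
open Summit.CriticalPhenomena.CardyFormulaZ2.Theses.CardySelfRefinement

/-! ### Locality is transported by relabellings -/

-- adapted from Literature/Probability/Percolation/NewmanSchulman.lean (`DeterminedBy.preimage_relabel`)
/-- Relabelling transports finite dependence: if `A` is determined by the pairs in `F`, then the
pull-back `{ω | e • ω ∈ A}` is determined by `e⁻¹(F)`. -/
theorem determinedBy_preimage_relabel_symm_image {F : Set (Sym2 (Site 2))}
    {A : Set (BondConfig (Site 2))} (hA : DeterminedBy A F) (e : Sym2 (Site 2) ≃ Sym2 (Site 2)) :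
    DeterminedBy (BondConfig.relabel e ⁻¹' A) (e.symm '' F) := by
  rw [determinedBy_iff] at hA ⊢
  intro ω ω' h
  simp only [Set.mem_preimage]
  apply hA
  ext z
  simp only [Set.mem_inter_iff, BondConfig.mem_relabel_iff]
  constructor
  · rintro ⟨hz, hzF⟩
    have : e.symm z ∈ ω' ∩ e.symm '' F := by
      rw [← h]; exact ⟨hz, Set.mem_image_of_mem _ hzF⟩
    exact ⟨this.1, hzF⟩
  · rintro ⟨hz, hzF⟩
    have : e.symm z ∈ ω ∩ e.symm '' F := by
      rw [h]; exact ⟨hz, Set.mem_image_of_mem _ hzF⟩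
    exact ⟨this.1, hzF⟩

/-! ### The ordered free three-arm event is local -/

/-- The arm window grows with the reach: `armSites j m R ⊆ armSites j m (2R)`. -/
theorem armSites_subset_armSites_two_mul (j : ℤ) (m R : ℕ) :
    Z2HalfPlane.armSites j m R ⊆ Z2HalfPlane.armSites j m (2 * R) := by
  intro w hw
  rw [Z2HalfPlane.mem_armSites] at hw ⊢
  push_cast at hw ⊢
  omega

/-- **The ordered free three-arm event is a local event**: it is read off the pairs of
`armSites j m (2R)` (the legs and the open arms to reach `R` off the pairs of
`armSites j m R ⊆ armSites j m (2R)`, the closed dual arm to reach `2R` off those of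
`armSites j m (2R)`; `Z2HalfPlane.leg_mem_iff_of_inter_eq`, `openConnIn_iff_of_inter_eq`,
`dualConfig_openConnIn_iff_of_inter_eq`). -/
theorem determinedBy_threeArmFree (j : ℤ) (m R : ℕ) :
    DeterminedBy {ω : BondConfig (Site 2) | ∃ a b a' : ℤ, (j ≤ a ∧ a ≤ b ∧ b < a' ∧ a' < j + m) ∧
        Z2HalfPlane.leg a ∈ ω ∧ Z2HalfPlane.leg a' ∈ ω ∧
        (∃ v : Site 2, Z2HalfPlane.Far R a v ∧ ω ∈ openConnIn ↑(Z2HalfPlane.siteBox a R) ![a, 0] v) ∧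
        (∃ v' : Site 2, Z2HalfPlane.Far R a' v' ∧
          ω ∈ openConnIn ↑(Z2HalfPlane.siteBox a' R) ![a', 0] v') ∧
        ∃ g : Site 2, Z2HalfPlane.Far (2 * R) b g ∧
          dualConfig ω ∈ openConnIn ↑(Z2HalfPlane.faceBox b (2 * R)) ![b, -1] g}
      ↑(Z2HalfPlane.armSites j m (2 * R)).sym2 := by
  rw [determinedBy_iff]
  intro ω ω' h
  have h' : ω ∩ ↑(Z2HalfPlane.armSites j m R).sym2 = ω' ∩ ↑(Z2HalfPlane.armSites j m R).sym2 :=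
    Z2HalfPlane.inter_eq_of_subset h
      (Finset.coe_subset.2 (Finset.sym2_mono (armSites_subset_armSites_two_mul j m R)))
  simp only [mem_setOf_eq]
  refine exists_congr fun a => exists_congr fun b => exists_congr fun a' =>
    and_congr_right fun hab => ?_
  obtain ⟨hja, hab', hba', ham⟩ := hab
  exact and_congr (Z2HalfPlane.leg_mem_iff_of_inter_eq h' hja (by omega))
    (and_congr (Z2HalfPlane.leg_mem_iff_of_inter_eq h' (by omega) ham)
      (and_congr (exists_congr fun v => and_congr_right fun _ =>
          Z2HalfPlane.openConnIn_iff_of_inter_eq h' hja (by omega) v)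
        (and_congr (exists_congr fun v' => and_congr_right fun _ =>
            Z2HalfPlane.openConnIn_iff_of_inter_eq h' (by omega) ham v')
          (exists_congr fun g => and_congr_right fun _ =>
            Z2HalfPlane.dualConfig_openConnIn_iff_of_inter_eq h (by omega) (by omega) g))))

/-! ### The translated one-arm event is an arm event of `ω` around `(j,0) - p` -/

/-- **One arm of the translated configuration is an arm of `ω`.**  Let `ω` be a lattice
configuration whose translate `ω + p` has one arm from the window `[j, j+m)` to sup-distance `R`
(`Z2HalfPlane.oneArm j m R`: an open arm docked by an open leg at some `a ∈ [j, j+m)`, or a closed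
dual arm from the moat face under some `a`).  Then, for `m ≤ M`, `2 ≤ M` and `n' + m ≤ R`,
`ω` has a lattice walk from a site of `c + B(M-1)` to a site outside `c + B(n')`, `c = (j,0) - p`,
which is open, or all of whose edges are dual-open (`exists_walk_of_mem_openConnIn` on the
translate, translated back by `-p`; `Far R a ·` puts the far end outside `c + B(n')`). -/
theorem mem_union_of_relabel_shift_mem_oneArm (p : Site 2) {j : ℤ} {m R M n' : ℕ}
    (hmM : m ≤ M) (h2M : 2 ≤ M) (hn' : n' + m ≤ R) {ω : BondConfig (Site 2)}
    (hω : ω ⊆ (zdGraph 2).edgeSet)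
    (h : BondConfig.relabel (sym2Equiv (Site.shift p)) ω ∈ Z2HalfPlane.oneArm j m R) :
    ω ∈ {ω : BondConfig (Site 2) | ∃ (u w : Site 2) (q : (zdGraph 2).Walk u w),
          u - (![j, 0] - p) ∈ box 2 (M - 1) ∧ w - (![j, 0] - p) ∉ box 2 n' ∧
            ∀ e ∈ q.edges, e ∈ ω} ∪
      {ω : BondConfig (Site 2) | ∃ (u w : Site 2) (q : (zdGraph 2).Walk u w),
          u - (![j, 0] - p) ∈ box 2 (M - 1) ∧ w - (![j, 0] - p) ∉ box 2 n' ∧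
            ∀ e ∈ q.edges, e ∈ dualConfig ω} := by
  obtain ⟨a, hja, ham, harm⟩ := h
  have hshift : ∀ x : Site 2, (zdShiftIso (-p)).toHom x - (![j, 0] - p) = x - ![j, 0] := by
    intro x
    show x + -p - (![j, 0] - p) = x - ![j, 0]
    abel
  -- the two possible starts lie in `c + B(M-1)`
  have hstart0 : (![a, 0] : Site 2) - ![j, 0] ∈ box 2 (M - 1) := by
    rw [mem_box]
    intro i
    fin_cases i <;> simp
    omega
  have hstart1 : (![a, -1] : Site 2) - ![j, 0] ∈ box 2 (M - 1) := by
    rw [mem_box]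
    intro i
    fin_cases i <;> simp <;> omega
  -- `Far R a x` puts `x - (j,0)` outside `B(n')`
  have hfar : ∀ x : Site 2, Z2HalfPlane.Far R a x → x - ![j, 0] ∉ box 2 n' := by
    intro x hx hbox
    rw [mem_box] at hbox
    have h0 := hbox 0
    have h1 := hbox 1
    simp at h0 h1
    unfold Z2HalfPlane.Far at hx
    rcases hx with hx | hx
    · rw [le_abs] at hx
      omega
    · omega
  rcases harm with ⟨-, v, hv, hv'⟩ | ⟨g, hg, hg'⟩
  · -- an open arm docked at `a`
    obtain ⟨q, -, hqω⟩ := exists_walk_of_mem_openConnIn (relabel_shift_subset_edgeSet p hω) hv'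
    have hq' := forall_edges_map_shift_mem_relabel (v := -p) q hqω
    rw [relabel_shift_neg_relabel_shift] at hq'
    refine Or.inl ⟨_, _, q.map (zdShiftIso (-p)).toHom, ?_, ?_, hq'⟩
    · rw [hshift]
      exact hstart0
    · rw [hshift]
      exact hfar v hv
  · -- a closed dual arm from the moat face under `a`
    rw [dualConfig_relabel_shift] at hg'
    obtain ⟨q, -, hqω⟩ := exists_walk_of_mem_openConnIn
      (relabel_shift_subset_edgeSet p (fun _ he => (mem_dualConfig_iff.1 he).1)) hg'
    have hq' := forall_edges_map_shift_mem_relabel (v := -p) q hqω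
    rw [relabel_shift_neg_relabel_shift] at hq'
    refine Or.inr ⟨_, _, q.map (zdShiftIso (-p)).toHom, ?_, ?_, hq'⟩
    · rw [hshift]
      exact hstart1
    · rw [hshift]
      exact hfar g hg

/-! ### The registered stub: the free-side three-arm window bound for `M_2` along the path -/

/-- **(W2b) The free-side docked half-plane three-arm window bound for `M_2` along an RSW path,
exponent `1 + α`** (Lawler–Schramm–Werner, App. A, window form, for the self-refinement law
`M_2(γ s)` read after the vertical translation by `t`).  ASSUMING the coin-space inclusion (W2a)
`cfg 2 ⁻¹' {three arms} ⊆ (cfg 2 ⁻¹' twoArm) □ (cfg 2 ⁻¹' oneArm)` (`hincl`) and the two-arm window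
bound `M_2(γ s){ω | ω + (0,t) ∈ twoArm j m R} ≤ C m/n` (`htwo`), there are `C, α > 0` and `K ≥ 1`
such that for all `s`, `t`, `j` and all `1 ≤ m ≤ n`, `K n ≤ R`, the `M_2(γ s)`-probability that
`ω + (0,t)` has the ordered free three arms from the window `[j, j+m)` (open legs `a < a'` with
open arms to sup-distance `R`, a closed dual arm from a moat face `b ∈ [a, a')` to sup-distance
`2R`) is at most `C (m/n)^{1+α}`: Reimer's inequality on the coin space
(`M_real_le_mul_of_preimage_subset_disjointOccurrence`) bounds it by
`M_2(two arms) · M_2(one arm) ≤ (C₂ m/n) · c (m/n)^α`, the one-arm factor by the primal and dual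
one-arm decays along the path (`openArm_decay_along`, `dualArm_decay_along`). -/
theorem threeArmFree_window_along_two {γ : unitInterval → ℝ × ℝ} (hγ : PathOK 2 γ)
    (hincl : ∀ (t j : ℤ) (m R : ℕ), m < R →
      cfg 2 ⁻¹' (BondConfig.relabel (sym2Equiv (Site.shift (![0, t] : Site 2))) ⁻¹'
        {ω | ∃ a b a' : ℤ, (j ≤ a ∧ a ≤ b ∧ b < a' ∧ a' < j + m) ∧
          Z2HalfPlane.leg a ∈ ω ∧ Z2HalfPlane.leg a' ∈ ω ∧
          (∃ v : Site 2, Z2HalfPlane.Far R a v ∧ ω ∈ openConnIn ↑(Z2HalfPlane.siteBox a R) ![a, 0] v) ∧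
          (∃ v' : Site 2, Z2HalfPlane.Far R a' v' ∧
            ω ∈ openConnIn ↑(Z2HalfPlane.siteBox a' R) ![a', 0] v') ∧
          ∃ g : Site 2, Z2HalfPlane.Far (2 * R) b g ∧
            dualConfig ω ∈ openConnIn ↑(Z2HalfPlane.faceBox b (2 * R)) ![b, -1] g}) ⊆
      disjointOccurrence
        (cfg 2 ⁻¹' (BondConfig.relabel (sym2Equiv (Site.shift (![0, t] : Site 2))) ⁻¹'
          Z2HalfPlane.twoArm j m R))
        (cfg 2 ⁻¹' (BondConfig.relabel (sym2Equiv (Site.shift (![0, t] : Site 2))) ⁻¹'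
          Z2HalfPlane.oneArm j m R)))
    (htwo : ∃ C : ℝ, 0 < C ∧ ∃ K : ℕ, 1 ≤ K ∧ ∀ (s : unitInterval) (t j : ℤ) (m n R : ℕ),
      1 ≤ m → m ≤ n → K * n ≤ R →
        (M 2 (γ s).1 (γ s).2).real
          (BondConfig.relabel (sym2Equiv (Site.shift (![0, t] : Site 2))) ⁻¹' Z2HalfPlane.twoArm j m R) ≤
          C * m / n) :
    ∃ C α : ℝ, 0 < C ∧ 0 < α ∧ ∃ K : ℕ, 1 ≤ K ∧ ∀ (s : unitInterval) (t j : ℤ) (m n R : ℕ),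
      1 ≤ m → m ≤ n → K * n ≤ R →
        (M 2 (γ s).1 (γ s).2).real
          (BondConfig.relabel (sym2Equiv (Site.shift (![0, t] : Site 2))) ⁻¹'
            {ω | ∃ a b a' : ℤ, (j ≤ a ∧ a ≤ b ∧ b < a' ∧ a' < j + m) ∧
              Z2HalfPlane.leg a ∈ ω ∧ Z2HalfPlane.leg a' ∈ ω ∧
              (∃ v : Site 2, Z2HalfPlane.Far R a v ∧
                ω ∈ openConnIn ↑(Z2HalfPlane.siteBox a R) ![a, 0] v) ∧
              (∃ v' : Site 2, Z2HalfPlane.Far R a' v' ∧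
                ω ∈ openConnIn ↑(Z2HalfPlane.siteBox a' R) ![a', 0] v') ∧
              ∃ g : Site 2, Z2HalfPlane.Far (2 * R) b g ∧
                dualConfig ω ∈ openConnIn ↑(Z2HalfPlane.faceBox b (2 * R)) ![b, -1] g}) ≤
          C * ((m : ℝ) / n) ^ (1 + α) := by
  obtain ⟨C₂, hC₂, K₂, hK₂, htwo⟩ := htwo
  obtain ⟨c₁, a₁, hc₁, ha₁, m₁, hopen⟩ := openArm_decay_along (k := 2) (Or.inl rfl) hγ
  obtain ⟨c₂, a₂, hc₂, ha₂, m₂, hdual⟩ := dualArm_decay_along (k := 2) (Or.inl rfl) hγ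
  have hα0 : 0 < min a₁ a₂ := lt_min ha₁ ha₂
  refine ⟨C₂ * ((c₁ + c₂) * (((m₁ : ℝ) + m₂ + 2) ^ min a₁ a₂)), min a₁ a₂, by positivity, hα0,
    K₂ + (m₁ + m₂) + 3, by omega, fun s t j m n R hm hmn hR => ?_⟩
  haveI : IsProbabilityMeasure (M 2 (γ s).1 (γ s).2) := isProbabilityMeasure_M 2 _ _
  -- the scales
  have hn : 1 ≤ n := hm.trans hmn
  have hKn : (K₂ + (m₁ + m₂) + 3) * n = K₂ * n + (m₁ + m₂) * n + 3 * n := by ring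
  have hK₂n : n ≤ K₂ * n := Nat.le_mul_of_pos_left n hK₂
  have hm₀n : m₁ + m₂ ≤ (m₁ + m₂) * n := Nat.le_mul_of_pos_right _ hn
  have hK₂R : K₂ * n ≤ R := by omega
  have hmR : m < R := by omega
  obtain ⟨n', hn'⟩ : ∃ n' : ℕ, n' + m = R := ⟨R - m, by omega⟩
  have hn'n : n ≤ n' := by omega
  obtain ⟨Mr, hMr⟩ : ∃ Mr : ℕ, Mr = m + (m₁ + m₂) + 1 := ⟨_, rfl⟩
  have hMn' : Mr ≤ n' := by omega
  have hn0 : (0 : ℝ) < n := by exact_mod_cast (show 0 < n by omega)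
  have hn'0 : (0 : ℝ) < n' := by exact_mod_cast (show 0 < n' by omega)
  have hm0 : (0 : ℝ) < m := by exact_mod_cast hm
  have hmnpos : 0 < (m : ℝ) / n := by positivity
  -- the translation and the locality of the arm events
  have hTm : Measurable (BondConfig.relabel (sym2Equiv (Site.shift (![0, t] : Site 2)))) :=
    MeasurableEquiv.measurable _
  have hAW := determinedBy_preimage_relabel_symm_image (Z2HalfPlane.determinedBy_twoArm j m R)
    (sym2Equiv (Site.shift (![0, t] : Site 2)))
  have hBW := determinedBy_preimage_relabel_symm_image (Z2HalfPlane.determinedBy_oneArm j m R)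
    (sym2Equiv (Site.shift (![0, t] : Site 2)))
  have hfin : ((sym2Equiv (Site.shift (![0, t] : Site 2))).symm ''
      (↑(Z2HalfPlane.armSites j m R).sym2 : Set (Sym2 (Site 2)))).Finite :=
    (Finset.finite_toSet _).image _
  -- Step 1: Reimer's inequality on the coin space
  refine (M_real_le_mul_of_preimage_subset_disjointOccurrence 2 (γ s).1 (γ s).2
    (hTm (determinedBy_threeArmFree j m R).measurableSet_of_finset)
    (hTm (Z2HalfPlane.determinedBy_twoArm j m R).measurableSet_of_finset)
    (hTm (Z2HalfPlane.determinedBy_oneArm j m R).measurableSet_of_finset)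
    hfin hfin hAW hBW (hincl t j m R hmR)).trans ?_
  -- Step 2: the two-arm window bound
  have h2 := htwo s t j m n R hm hmn hK₂R
  -- Step 3: the price of the third arm
  have h1 : (M 2 (γ s).1 (γ s).2).real
      (BondConfig.relabel (sym2Equiv (Site.shift (![0, t] : Site 2))) ⁻¹' Z2HalfPlane.oneArm j m R) ≤
      (c₁ + c₂) * (((m₁ : ℝ) + m₂ + 2) ^ min a₁ a₂ * ((m : ℝ) / n) ^ min a₁ a₂) := by
    have hsub : (M 2 (γ s).1 (γ s).2).real
        (BondConfig.relabel (sym2Equiv (Site.shift (![0, t] : Site 2))) ⁻¹'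
          Z2HalfPlane.oneArm j m R) ≤
        (M 2 (γ s).1 (γ s).2).real
          ({ω : BondConfig (Site 2) | ∃ (u w : Site 2) (q : (zdGraph 2).Walk u w),
              u - (![j, 0] - ![0, t]) ∈ box 2 (Mr - 1) ∧ w - (![j, 0] - ![0, t]) ∉ box 2 n' ∧
                ∀ e ∈ q.edges, e ∈ ω} ∪
            {ω : BondConfig (Site 2) | ∃ (u w : Site 2) (q : (zdGraph 2).Walk u w),
              u - (![j, 0] - ![0, t]) ∈ box 2 (Mr - 1) ∧ w - (![j, 0] - ![0, t]) ∉ box 2 n' ∧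
                ∀ e ∈ q.edges, e ∈ dualConfig ω}) := by
      refine ENNReal.toReal_mono (measure_ne_top _ _) (measure_mono_ae ?_)
      have hae : ∀ᵐ ω ∂(M 2 (γ s).1 (γ s).2), ω ⊆ (zdGraph 2).edgeSet :=
        selfRefinementMeasure_ae_subset_edgeSet 2 (γ s).1 (γ s).2
      filter_upwards [hae] with ω hω hB
      exact mem_union_of_relabel_shift_mem_oneArm (![0, t]) (by omega) (by omega) hn'.le hω hB
    have hO := hopen s (![j, 0] - ![0, t]) Mr n' (by omega) hMn'
    have hD := hdual s (![j, 0] - ![0, t]) Mr n' (by omega) hMn'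
    -- arithmetic with the ratio `x = Mr / n' ≤ 1`, `x ≤ (m₁ + m₂ + 2) m / n`
    have hx0 : (0 : ℝ) ≤ (Mr : ℝ) / n' := by positivity
    have hx1 : (Mr : ℝ) / n' ≤ 1 := by
      rw [div_le_one hn'0]
      exact_mod_cast hMn'
    have hxle : (Mr : ℝ) / n' ≤ ((m₁ : ℝ) + m₂ + 2) * ((m : ℝ) / n) := by
      have hA : Mr ≤ (m₁ + m₂ + 2) * m := by
        have h3 : m₁ + m₂ ≤ (m₁ + m₂) * m := Nat.le_mul_of_pos_right _ hm
        have e : (m₁ + m₂ + 2) * m = (m₁ + m₂) * m + 2 * m := by ring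
        omega
      have hB : Mr * n ≤ (m₁ + m₂ + 2) * m * n' := Nat.mul_le_mul hA hn'n
      have hB' : (Mr : ℝ) * n ≤ ((m₁ : ℝ) + m₂ + 2) * m * n' := by exact_mod_cast hB
      rw [div_le_iff₀ hn'0,
        show ((m₁ : ℝ) + m₂ + 2) * ((m : ℝ) / n) * n' = ((m₁ : ℝ) + m₂ + 2) * m * n' / n by ring,
        le_div_iff₀ hn0]
      exact hB'
    have hα₁ : ((Mr : ℝ) / n') ^ a₁ ≤ ((Mr : ℝ) / n') ^ min a₁ a₂ :=
      Real.rpow_le_rpow_of_exponent_ge' hx0 hx1 hα0.le (min_le_left _ _)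
    have hα₂ : ((Mr : ℝ) / n') ^ a₂ ≤ ((Mr : ℝ) / n') ^ min a₁ a₂ :=
      Real.rpow_le_rpow_of_exponent_ge' hx0 hx1 hα0.le (min_le_right _ _)
    have hxα : ((Mr : ℝ) / n') ^ min a₁ a₂ ≤
        ((m₁ : ℝ) + m₂ + 2) ^ min a₁ a₂ * ((m : ℝ) / n) ^ min a₁ a₂ := by
      rw [← Real.mul_rpow (by positivity) (by positivity)]
      exact Real.rpow_le_rpow hx0 hxle hα0.le
    refine hsub.trans ((measureReal_union_le _ _).trans ((add_le_add hO hD).trans ?_))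
    calc c₁ * ((Mr : ℝ) / n') ^ a₁ + c₂ * ((Mr : ℝ) / n') ^ a₂
        ≤ c₁ * ((Mr : ℝ) / n') ^ min a₁ a₂ + c₂ * ((Mr : ℝ) / n') ^ min a₁ a₂ :=
          add_le_add (mul_le_mul_of_nonneg_left hα₁ hc₁.le) (mul_le_mul_of_nonneg_left hα₂ hc₂.le)
      _ = (c₁ + c₂) * ((Mr : ℝ) / n') ^ min a₁ a₂ := by ring
      _ ≤ (c₁ + c₂) * (((m₁ : ℝ) + m₂ + 2) ^ min a₁ a₂ * ((m : ℝ) / n) ^ min a₁ a₂) :=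
          mul_le_mul_of_nonneg_left hxα (by positivity)
  -- Step 4: multiply
  refine (mul_le_mul h2 h1 measureReal_nonneg (by positivity)).trans (le_of_eq ?_)
  rw [Real.rpow_add hmnpos, Real.rpow_one]
  ring

end Summit.CriticalPhenomena.CardyFormulaZ2.Theorems.CardySelfRefinement.FarField

end
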